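import Summits.QuantumFields.BalabanUV.Beta.FP.PeriodisedBorderIndexWard
import Summits.QuantumFields.BalabanUV.Beta.FP.PeriodisedWardOrderZero
import Summits.QuantumFields.BalabanUV.Beta.GAN24.Push3GaugeSlotCells

/-!
# `BalabanUV.Beta.FP.PeriodisedFormIndexWard` — road «FP» for binder row D1, ROUTE T, (T-β-1) AT ORDER 1 FOR THE FORM BLOCK AT LEVEL 0:
# **THE PERIODISED WILSON TABLE INSERTED ALONG A TORUS PURE GAUGE IS ONE HALF THE COMMUTATOR OF THE FORM BLOCK WITH THE DIAGONAL GAUGE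
# GENERATOR** — at the torus call's types (`hH₀` of `NestedStepLawTorusInstance` ∕ `…Delta` ∕ `…TorusTransported` at `j = 0`), for every torus gauge
# parameter `s`: `Σ_b tgrad F (b.1, inl b.2) s • H₁^{b} = ½ • (H₀ * E_s − E_s * H₀)`, `E_s = diagonal (tdelta F b.1 s)`; along any torus gauge function
# `λ`: `H₁^{(Dλ)} = ½ • (H₀·E_λ − E_λ·H₀)`; hence, for a weighted family `w • H₁`, the SIMILARITY first-order word `−X·H₀ + w•H₁^{(h)} + H₀·X = w•H₁^{(h + Dλ)}`
# with the DIAGONAL `X = (w/2) • E_λ` HOLDS for every direction `h`, while the CONGRUENCE word `Xᵀ·H₀ + w•H₁^{(h)} + H₀·X = w•H₁^{(h + Dλ)}` (any `X`) forces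
# `w • (H₀·E_λ − E_λ·H₀) = 0`

HONEST DEPENDENCY (page 1, mandatory): continuum YM on T⁴ ⇐ BetaPertH ∧ nine spine estimates (0/9 proved); BetaPertH ⇐ (D1) ∧ (D4) ∧ CAP+tail;
G-an2-4 gates asym, D1 and NE2/3/4.  HONEST FRAMING (cell contract, verbatim): «discharging `BetaPertH` makes Bałaban's UV stability UNCONDITIONAL —
a real constructive-QFT result; it is NOT the continuum limit and NOT the Clay problem.»  ABSOLUTE RULE (cell charter, verbatim): «No internally-minted
statement may enter as a cited fact. Every hypothesis is either kernel-proved in this package or a verbatim quotation of a PUBLISHED theorem with page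
reference. The manuscript(s) under audit are NOT citable for their own disputed steps — they are the thing under adjudication; programme-internal
(2001/route/tribunal) claims are never citable.»  THIS MODULE is [folklore] re-indexing of FINITE sums over OUR typed objects, fed BY NAME by this lineage's
Wilson Ward divergence law `WilsonDivergenceContact.divV_wilsonA_inl_inl` (leaf-05 gen 2: `Σ_γ (wilsonA γ (u − e_γ) − wilsonA γ u) x z (inl a) (inl b) =
½·(d*d δ_{(b,z)})_a(x)·([z = u] − [x = u])`), leaf-02 g18's generic periodisation lemma `PeriodisedBorderIndexWard.sum_tgrad_mul_perZ_dper_of_indexLaw`, GAN24's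
support letters of the Wilson table (`Push3GaugeSlotCells.wilsonA_ff_eq_zero_of_not_mem_left`, `ContactOneGaugeCellAlgebra.wilsonA_inl_inl_eq_zero_of_lt_idx`),
lit-balaban's `StepJetData.wilsonA_translate`, gan24-leaf-05's `tgrad`∕`tdelta`, and leaf-02's `PeriodisedWardOrderZero.torus_H₀_transpose`; no `def`, no
`def … : Prop`, nothing cited, 0 sorry; 0 estimates; 0∕4 row-D1 binders; NOT (T-β) complete (levels `j ≥ 1` — the form block `wVH·E2` and an3's
`E3CoDressedContact` currency — and order 2 are the dictionary's ∕ the OWNER's), NOT SDF, NOT D1, NOT BetaPertH, NOT continuum, NOT Clay.  «not in print; our bookkeeping».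

WHY (OWNER d1-p3 g18, `NestedStepLawTorusTransported` p320614 LANDED-3: «OPEN rows: `k1 k2` (form block) …»; memo §23 (23b) ∕ TID-LETTER-SPEC § F row (β-1)
«`Xᵀ H₀ + H₁ + H₀ X = H♯₁` … an1's form tables along `Π_big e_b` are the conjugated tables along `Π_nest e_b` (covariance of the one-step form)»).  The
two insertion directions differ by a PURE GAUGE `Dψ` and the form insertion table is LINEAR in the direction, so at order 1 the letter is the statement
that the form table inserted along `Dψ` is a word in `H₀` and a generator.  For the AVERAGING block leaf-02 (p319514 ∕ p320102) showed that word is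
`c·(R_λ·Q₁₀ − Q₁₀·E_λ)` with DIAGONAL generators.  This file does the same for the FORM block at level 0 (where the form block is the windowed `d*d` of
`bhKAt` and its insertion table is an2∕an3's antisymmetrised colourless Wilson cubic stencil `StepJetData.wilsonA`): the word is `½·(H₀·E_λ − E_λ·H₀)`.

CONTENT (generic `d`; any box `M`; any root `ρ`, window `L` — the form block of `bhKAt d ρ L` does not depend on them).
* §1 `sum_wilsonA_sub` — the g2 law in leaf-02's `hlaw` Σ-shape with the contact kernel `q := (−½) • ffK (bhKAt d ρ L)` and `p₁ = id`; the window
  letters `wilsonA_ff_eq_zero_of_not_mem_S ∕ _T`, `smul_ffK_bhKAt_eq_zero_of_not_mem_S`.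
* §2 **`sum_tgrad_mul_perZ_dper_wilsonA`** (leaf-02's generic lemma at block size `1`: the Wilson table is FINE-translation covariant):
  `Σ_{u ∈ pbox M} Σ_κ tgrad M (u, inl κ) s · perZ M (dper M (wilsonA d κ u)) x z (inl α) (inl β) = (tdelta M x s − tdelta M z s) · perZ M q x z (inl α) (inl β)`;
  `perZ_smul_ffK_bhKAt_inl_inl`; **`sum_tgrad_mul_perZ_dper_wilsonA_bhKStepAt`** (in the torus call's letters, `bhKStepAt d ρ L 0`).
* §3 matrix forms: **`torus_form_pureGauge_of_box`** (ANY box), **`torus_H1_pureGauge`** ∕ **`torus_H1_pureGauge_fun`** (the call's types `F = fine Lc M′`,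
  `hH₀` VERBATIM at `j = 0`): `Σ_b tgrad F (b.1, inl b.2) s • H₁^{b} = ½ • (H₀ * E_s − E_s * H₀)`, `Σ_b (Dλ)_b • H₁^{b} = ½ • (H₀ * E_λ − E_λ * H₀)`;
  **`torus_H1_gauge_shift`**: `H₁^{(h+Dλ)} − H₁^{(h)} = ½ • (H₀·E_λ − E_λ·H₀)` (the OWNER's requested shape, F-FP-18-2).
* §4 pure algebra: `transpose_congr_increment` ∕ `transpose_comm_diagonal` ∕ `add_mid_cancel` ∕ `eq_zero_of_transpose_eq_of_transpose_eq_neg`.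
* §5 in p320614's binder currency with a WEIGHTED family `w • H₁` (OWNER W-FP-18-6 «display whatever constant the tables carry»): **`torus_k1_sim_letter`**
  (`X := (w/2) • E_λ` DIAGONAL: `−X·H₀ + w•H₁^{(h)} + H₀·X = w•H₁^{(h+Dλ)}` HOLDS; at leaf-02's pin `X = −(c • E_λ)` this is `w = −2c`) and **`torus_k1_congr_letter_only_if`**
  (`Xᵀ·H₀ + w•H₁^{(h)} + H₀·X = w•H₁^{(h+Dλ)}` for ANY `X` ⇒ `w • (H₀·E_λ − E_λ·H₀) = 0` ∧ `Xᵀ·H₀ + H₀·X = 0` — no constant repairs the congruence shape).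
NOT HERE: which table the dictionary instantiates as `H₁` at the record, the weight it carries relative to the averaging block, levels `j ≥ 1`, order 2,
and whether the OWNER's T-β assembly takes the similarity or the congruence word for the form block (LOCATED QUESTION Q-leaf05-g27-1, journal).
Provenance: D1 formalisation swarm LEAF PROVER 05, unit b2b-balaban-beta-d1-formalise-leaf-05 gen 27, 2026-08-22.  No existing file touched.
-/

noncomputable section

open scoped BigOperators

namespace Summit.QuantumFields.BalabanUV.Beta.FP.PeriodisedFormIndexWard

open Finset Matrix
open Literature.MathematicalPhysics.QuantumFieldTheory.Balaban1983to89
open Literature.MathematicalPhysics.QuantumFieldTheory.Balaban1983to89.Beta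
open B12Sec2to5 (l1)
open B5Prop11Plancherel (fine)
open B6Lemma24Torus (pbox mem_pbox)
open ExpKernelCalculus (MKer shiftK)
open StepJetData (wilsonA wilsonA_translate)
open AffineAveraging (Site box toSite unitVec)
open OneStepResolventKernel (Fib)
open KernelWard (divV)
open Summit.QuantumFields.BalabanUV.Beta.BorderedHessian (bhK bhKAt bhKAt_inl_inl bhK_inl_inl bhK_inl_inl_eq bhKStepAt bhKStepAt_zero)
open Summit.QuantumFields.BalabanUV.Beta.AxialDressingRooted (cube mem_cube)
open Summit.QuantumFields.BalabanUV.Beta.WardLocusStencils (ffK ffK_inl_inl divV_apply)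
open Summit.QuantumFields.BalabanUV.Beta.WilsonDivergenceContact (divV_wilsonA_inl_inl)
open Summit.QuantumFields.BalabanUV.Beta.GAN24.ContactOneGaugeCellAlgebra (affine_unitVec_eq mem_cube_two_of_l1_le wilsonA_inl_inl_eq_zero_of_lt_idx)
open Summit.QuantumFields.BalabanUV.Beta.GAN24.Push3GaugeSlotCells (wilsonA_ff_eq_zero_of_not_mem_left)
open Summit.QuantumFields.BalabanUV.Beta.FP.KernelPeriodisationFib (Idx perF perF_apply perZ perZ_apply)
open Summit.QuantumFields.BalabanUV.Beta.FP.KernelPeriodisationFibLoc (dper)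
open Summit.QuantumFields.BalabanUV.Beta.FP.TorusGaugeCovariance (tdelta tgrad)
open Summit.QuantumFields.BalabanUV.Beta.FP.TorusGaugeCovariancePairing (sum_tdelta_mul wrapPt_of_mem)
open Summit.QuantumFields.BalabanUV.Beta.FP.PeriodisedBorderIndexWard (sum_tgrad_mul_perZ_dper_of_indexLaw)
open Summit.QuantumFields.BalabanUV.Beta.FP.PeriodisedWardOrderZero (torus_H₀_transpose)

variable {d : ℕ}

/-! ## §1 The Wilson table's index-slot law in `Σ`-form and its window letters -/

section Law

/-- [folklore] **THE INDEX-SLOT LAW OF THE WILSON TABLE IN `Σ`-FORM** (this lineage's `divV_wilsonA_inl_inl` with `divV` unfolded, all four blocks):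
`Σ_κ (wilsonA κ (w − e_κ) − wilsonA κ w) x z a b = ([x = w] − [z = w]) · q x z a b`, contact kernel `q := (−½) • ffK (bhKAt d ρ L)` (any root `ρ`,
any window `L`: the form block of `bhKAt` carries neither) — a field leg rotates at ITS OWN site (`p₁ = id`). -/
theorem sum_wilsonA_sub (ρ : Site (d + 1)) (L : ℕ) (w x z : Site (d + 1)) (a b : Fib d) :
    ∑ κ : Fin (d + 1), (wilsonA d κ (w - unitVec κ) x z a b - wilsonA d κ w x z a b)
      = ((if x = w then (1 : ℝ) else 0) - (if z = w then 1 else 0)) * ((-(1 / 2 : ℝ)) • ffK (bhKAt d ρ L)) x z a b := by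
  have hdiv : ∑ κ : Fin (d + 1), (wilsonA d κ (w - unitVec κ) x z a b - wilsonA d κ w x z a b) = divV (wilsonA d) w x z a b := by
    rw [divV_apply]
    exact Finset.sum_congr rfl fun κ _ => by rw [affine_unitVec_eq]
  rw [hdiv, Pi.smul_apply, Pi.smul_apply, Pi.smul_apply, Pi.smul_apply, smul_eq_mul]
  rcases a with α | μ <;> rcases b with β | ν
  · rw [divV_wilsonA_inl_inl, ffK_inl_inl, bhKAt_inl_inl, bhK_inl_inl_eq]
    ring
  · rw [WilsonDivergenceContact.divV_wilsonA_inl_inr, WardLocusStencils.ffK_inl_inr, mul_zero, mul_zero]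
  · rw [WilsonDivergenceContact.divV_wilsonA_inr_inl, WardLocusStencils.ffK_inr_inl, mul_zero, mul_zero]
  · rw [WilsonDivergenceContact.divV_wilsonA_inr_inr, WardLocusStencils.ffK_inr_inr, mul_zero, mul_zero]

/-- [folklore] window letter `hS`: the field–field entry of the Wilson table vanishes unless the RIGHT site lies in `x − cube 4`. -/
theorem wilsonA_ff_eq_zero_of_not_mem_S (κ : Fin (d + 1)) (u x : Site (d + 1)) (α β : Fin (d + 1)) :
    ∀ z ∉ (cube (d + 1) 4).image (fun v => x - v), wilsonA d κ u x z (Sum.inl α) (Sum.inl β) = 0 := fun z hz => by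
  refine wilsonA_ff_eq_zero_of_not_mem_left fun hxz => hz ?_
  exact Finset.mem_image.2 ⟨x - z, hxz, sub_sub_cancel x z⟩

/-- [folklore] window letter `hT`: the field–field entry of the Wilson table vanishes unless the INDEX site lies in `x − cube 2`. -/
theorem wilsonA_ff_eq_zero_of_not_mem_T (κ : Fin (d + 1)) (x z : Site (d + 1)) (α β : Fin (d + 1)) :
    ∀ u ∉ (cube (d + 1) 2).image (fun v => x - v), wilsonA d κ u x z (Sum.inl α) (Sum.inl β) = 0 := fun u hu => by
  refine wilsonA_inl_inl_eq_zero_of_lt_idx κ u x z α β (not_le.1 fun h => hu ?_)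
  exact Finset.mem_image.2 ⟨x - u, mem_cube_two_of_l1_le h, sub_sub_cancel x u⟩

/-- [folklore] window letter `hqS`: the contact kernel's field–field entry vanishes unless the RIGHT site lies in `x − cube 4` (the `d*d` window `cube 2`). -/
theorem smul_ffK_bhKAt_eq_zero_of_not_mem_S (c : ℝ) (ρ : Site (d + 1)) (L : ℕ) (x : Site (d + 1)) (α β : Fin (d + 1)) :
    ∀ z ∉ (cube (d + 1) 4).image (fun v => x - v), (c • ffK (bhKAt d ρ L)) x z (Sum.inl α) (Sum.inl β) = 0 := fun z hz => by
  rw [Pi.smul_apply, Pi.smul_apply, Pi.smul_apply, Pi.smul_apply, smul_eq_mul, ffK_inl_inl, bhKAt_inl_inl, bhK_inl_inl]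
  split_ifs with h
  · exfalso
    refine hz (Finset.mem_image.2 ⟨x - z, mem_cube.2 fun i => ?_, sub_sub_cancel x z⟩)
    have hi := (mem_cube.1 h) i
    rw [Pi.sub_apply] at hi ⊢
    rw [abs_sub_comm]
    push_cast at hi ⊢
    linarith
  · rw [mul_zero]

end Law

/-! ## §2 The Wilson table family inserted along a torus pure gauge, periodised (leaf-02's generic lemma at block size `1`) -/

section Periodised

variable {M : Fin (d + 1) → ℕ} [∀ μ, NeZero (M μ)]

/-- [folklore] **`sum_tgrad_mul_perZ_dper_wilsonA` — THE WILSON TABLE FAMILY INSERTED ALONG A TORUS PURE GAUGE** (any box `M`; the family is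
FINE-translation covariant, so leaf-02's block-covariant lemma is used at block size `1`): for the torus gauge parameter `s` and field legs `(x, α)`, `(z, β)`,
`Σ_{u ∈ pbox M} Σ_κ tgrad M (u, inl κ) s · perZ M (dper M (wilsonA d κ u)) x z (inl α) (inl β) = (tdelta M x s − tdelta M z s) · perZ M ((−½) • ffK (bhKAt d ρ L)) x z (inl α) (inl β)`. -/
theorem sum_tgrad_mul_perZ_dper_wilsonA (ρ : Site (d + 1)) (L : ℕ) (s : ↥(pbox M)) (x z : Site (d + 1)) (α β : Fin (d + 1)) :
    ∑ u : ↥(pbox M), ∑ κ : Fin (d + 1), tgrad M (u, Sum.inl κ) s * perZ M (dper M (wilsonA d κ (u : Site (d + 1)))) x z (Sum.inl α) (Sum.inl β)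
      = (tdelta M x s - tdelta M z s) * perZ M ((-(1 / 2 : ℝ)) • ffK (bhKAt d ρ L)) x z (Sum.inl α) (Sum.inl β) :=
  sum_tgrad_mul_perZ_dper_of_indexLaw (M := M) (M' := M) (N := 1) (wilsonA d) ((-(1 / 2 : ℝ)) • ffK (bhKAt d ρ L)) (fun x => x)
    (fun x => (cube (d + 1) 4).image (fun v => x - v)) (fun x => (cube (d + 1) 2).image (fun v => x - v)) (Sum.inl α) (Sum.inl β)
    (fun i => (one_mul (M i)).symm) (fun κ u _ => wilsonA_translate κ u _)
    (fun κ u x => wilsonA_ff_eq_zero_of_not_mem_S κ u x α β) (fun κ x z => wilsonA_ff_eq_zero_of_not_mem_T κ x z α β)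
    (fun x => smul_ffK_bhKAt_eq_zero_of_not_mem_S _ ρ L x α β) (fun w x z => sum_wilsonA_sub ρ L w x z _ _) s x z

omit [∀ μ, NeZero (M μ)] in
/-- [folklore] the periodised contact kernel on the field–field block: `perZ M (c • ffK (bhKAt d ρ L)) =ff= c · perZ M (bhKStepAt d ρ L 0)`. -/
theorem perZ_smul_ffK_bhKAt_inl_inl (c : ℝ) (ρ : Site (d + 1)) (L : ℕ) [NeZero L] (x z : Site (d + 1)) (α β : Fin (d + 1)) :
    perZ M (c • ffK (bhKAt d ρ L)) x z (Sum.inl α) (Sum.inl β) = c * perZ M (bhKStepAt d ρ L 0) x z (Sum.inl α) (Sum.inl β) := by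
  rw [perZ_apply, perZ_apply, ← tsum_mul_left]
  exact tsum_congr fun m => by rw [Pi.smul_apply, Pi.smul_apply, Pi.smul_apply, Pi.smul_apply, smul_eq_mul, ffK_inl_inl, bhKStepAt_zero]

/-- [folklore] **IN THE TORUS CALL's LETTERS** (`H₀ = perF (bhKStepAt d ρ L 0)` on the field–field block): `Σ_u Σ_κ tgrad M (u, inl κ) s · perZ M (dper M (wilsonA d κ u)) x z (inl α) (inl β)
= ½ · (perZ M (bhKStepAt d ρ L 0) x z (inl α) (inl β) · tdelta M z s − tdelta M x s · perZ M (bhKStepAt d ρ L 0) x z (inl α) (inl β))` — BOTH field legs rotate at their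
own sites; the increment is the `(x, z)` entry of `½·(H₀·E_s − E_s·H₀)`. -/
theorem sum_tgrad_mul_perZ_dper_wilsonA_bhKStepAt (ρ : Site (d + 1)) (L : ℕ) [NeZero L] (s : ↥(pbox M)) (x z : Site (d + 1)) (α β : Fin (d + 1)) :
    ∑ u : ↥(pbox M), ∑ κ : Fin (d + 1), tgrad M (u, Sum.inl κ) s * perZ M (dper M (wilsonA d κ (u : Site (d + 1)))) x z (Sum.inl α) (Sum.inl β)
      = (1 / 2 : ℝ) * (perZ M (bhKStepAt d ρ L 0) x z (Sum.inl α) (Sum.inl β) * tdelta M z s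
          - tdelta M x s * perZ M (bhKStepAt d ρ L 0) x z (Sum.inl α) (Sum.inl β)) := by
  rw [sum_tgrad_mul_perZ_dper_wilsonA ρ L s x z α β, perZ_smul_ffK_bhKAt_inl_inl]
  ring

end Periodised

/-! ## §3 Matrix form: `Σ_b tgrad_{b s} • H₁^{b} = ½ • (H₀·E_s − E_s·H₀)` on any box, and at the torus call's types -/

section MatrixForm

/-- [folklore] **ANY BOX** `M` (root `ρ`, window `L` arbitrary): with `H₀ := perF M (bhKStepAt d ρ L 0)∘(fields, fields)` and the form insertion table family
`H₁^{b} := perF M (dper M (wilsonA d b.2 b.1))∘(fields, fields)`, for every torus gauge parameter `s`: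
`Σ_b tgrad M (b.1, inl b.2) s • H₁^{b} = ½ • (H₀ * E_s − E_s * H₀)`, `E_s := diagonal (tdelta M b.1 s)`. -/
theorem torus_form_pureGauge_of_box (M : Fin (d + 1) → ℕ) [∀ μ, NeZero (M μ)] (ρ : Site (d + 1)) (L : ℕ) [NeZero L] (s : ↥(pbox M))
    {H₀ : Matrix (↥(pbox M) × Fin (d + 1)) (↥(pbox M) × Fin (d + 1)) ℝ}
    (hH₀ : H₀ = (perF M (bhKStepAt d ρ L 0)).submatrix (fun b : ↥(pbox M) × Fin (d + 1) => ((b.1, Sum.inl b.2) : Idx M (Fib d)))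
        (fun b : ↥(pbox M) × Fin (d + 1) => ((b.1, Sum.inl b.2) : Idx M (Fib d)))) :
    (∑ b : ↥(pbox M) × Fin (d + 1), tgrad M (b.1, Sum.inl b.2) s •
        (perF M (dper M (wilsonA d b.2 (b.1 : Site (d + 1))))).submatrix
          (fun b : ↥(pbox M) × Fin (d + 1) => ((b.1, Sum.inl b.2) : Idx M (Fib d)))
          (fun b : ↥(pbox M) × Fin (d + 1) => ((b.1, Sum.inl b.2) : Idx M (Fib d))))
      = (1 / 2 : ℝ) • (H₀ * Matrix.diagonal (fun b : ↥(pbox M) × Fin (d + 1) => tdelta M (b.1 : Site (d + 1)) s)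
          - Matrix.diagonal (fun b : ↥(pbox M) × Fin (d + 1) => tdelta M (b.1 : Site (d + 1)) s) * H₀) := by
  subst hH₀
  ext x z
  rw [Matrix.sum_apply, Matrix.smul_apply, Matrix.sub_apply, Matrix.diagonal_mul, Matrix.mul_diagonal, smul_eq_mul]
  simp only [Matrix.smul_apply, Matrix.submatrix_apply, perF_apply, smul_eq_mul]
  rw [Fintype.sum_prod_type]
  exact sum_tgrad_mul_perZ_dper_wilsonA_bhKStepAt (M := M) ρ L s _ _ x.2 z.2

variable (M' : Fin (d + 1) → ℕ) [∀ μ, NeZero (M' μ)] {Lc : ℕ} [NeZero Lc] {r : Fin (d + 1) → ℕ}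

/-- [folklore] **`H₁^{(D e_s)} = ½·(H₀·E_s − E_s·H₀)` AT THE TORUS CALL's TYPES** (fine box `F = fine Lc M′`, in-block root `toSite r`; `hH₀` VERBATIM from p313662 ∕ the Delta ∕
p320614 at `j = 0`; `H₁^{b} := perF F (dper F (wilsonA d b.2 b.1))∘(fields, fields)`): for every torus gauge parameter `s`,
`Σ_b tgrad F (b.1, inl b.2) s • H₁^{b} = ½ • (H₀ * E_s − E_s * H₀)` with the DIAGONAL generator `E_s := diagonal (fun b => tdelta F b.1 s)` (a field leg rotates at the
base of its bond — BOTH legs, hence a commutator). -/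
theorem torus_H1_pureGauge (s : ↥(pbox (fine Lc M')))
    {H₀ : Matrix (↥(pbox (fine Lc M')) × Fin (d + 1)) (↥(pbox (fine Lc M')) × Fin (d + 1)) ℝ}
    (hH₀ : H₀ = (perF (fine Lc M') (bhKStepAt d (toSite r) Lc 0)).submatrix
        (fun b : ↥(pbox (fine Lc M')) × Fin (d + 1) => ((b.1, Sum.inl b.2) : Idx (fine Lc M') (Fib d)))
        (fun b : ↥(pbox (fine Lc M')) × Fin (d + 1) => ((b.1, Sum.inl b.2) : Idx (fine Lc M') (Fib d)))) :
    (∑ b : ↥(pbox (fine Lc M')) × Fin (d + 1), tgrad (fine Lc M') (b.1, Sum.inl b.2) s •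
        (perF (fine Lc M') (dper (fine Lc M') (wilsonA d b.2 (b.1 : Site (d + 1))))).submatrix
          (fun b : ↥(pbox (fine Lc M')) × Fin (d + 1) => ((b.1, Sum.inl b.2) : Idx (fine Lc M') (Fib d)))
          (fun b : ↥(pbox (fine Lc M')) × Fin (d + 1) => ((b.1, Sum.inl b.2) : Idx (fine Lc M') (Fib d))))
      = (1 / 2 : ℝ) • (H₀ * Matrix.diagonal (fun b : ↥(pbox (fine Lc M')) × Fin (d + 1) => tdelta (fine Lc M') (b.1 : Site (d + 1)) s)
          - Matrix.diagonal (fun b : ↥(pbox (fine Lc M')) × Fin (d + 1) => tdelta (fine Lc M') (b.1 : Site (d + 1)) s) * H₀) :=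
  torus_form_pureGauge_of_box (fine Lc M') (toSite r) Lc s hH₀

/-- [folklore] **ALONG ANY TORUS GAUGE FUNCTION** `λ : ↥(pbox F) → ℝ` (`(Dλ)_b := Σ_s tgrad F (b.1, inl b.2) s · λ s`):
`Σ_b (Dλ)_b • H₁^{b} = ½ • (H₀ * E_λ − E_λ * H₀)`, `E_λ := diagonal (fun b => λ b.1)`. -/
theorem torus_H1_pureGauge_fun (lam : ↥(pbox (fine Lc M')) → ℝ)
    {H₀ : Matrix (↥(pbox (fine Lc M')) × Fin (d + 1)) (↥(pbox (fine Lc M')) × Fin (d + 1)) ℝ}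
    (hH₀ : H₀ = (perF (fine Lc M') (bhKStepAt d (toSite r) Lc 0)).submatrix
        (fun b : ↥(pbox (fine Lc M')) × Fin (d + 1) => ((b.1, Sum.inl b.2) : Idx (fine Lc M') (Fib d)))
        (fun b : ↥(pbox (fine Lc M')) × Fin (d + 1) => ((b.1, Sum.inl b.2) : Idx (fine Lc M') (Fib d)))) :
    (∑ b : ↥(pbox (fine Lc M')) × Fin (d + 1), (∑ s : ↥(pbox (fine Lc M')), tgrad (fine Lc M') (b.1, Sum.inl b.2) s * lam s) •
        (perF (fine Lc M') (dper (fine Lc M') (wilsonA d b.2 (b.1 : Site (d + 1))))).submatrix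
          (fun b : ↥(pbox (fine Lc M')) × Fin (d + 1) => ((b.1, Sum.inl b.2) : Idx (fine Lc M') (Fib d)))
          (fun b : ↥(pbox (fine Lc M')) × Fin (d + 1) => ((b.1, Sum.inl b.2) : Idx (fine Lc M') (Fib d))))
      = (1 / 2 : ℝ) • (H₀ * Matrix.diagonal (fun b : ↥(pbox (fine Lc M')) × Fin (d + 1) => lam b.1)
          - Matrix.diagonal (fun b : ↥(pbox (fine Lc M')) × Fin (d + 1) => lam b.1) * H₀) := by
  -- linearity in `s`: swap the two finite sums and use `torus_H1_pureGauge` for each `s`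
  have hswap : (∑ b : ↥(pbox (fine Lc M')) × Fin (d + 1), (∑ s : ↥(pbox (fine Lc M')), tgrad (fine Lc M') (b.1, Sum.inl b.2) s * lam s) •
        (perF (fine Lc M') (dper (fine Lc M') (wilsonA d b.2 (b.1 : Site (d + 1))))).submatrix
          (fun b : ↥(pbox (fine Lc M')) × Fin (d + 1) => ((b.1, Sum.inl b.2) : Idx (fine Lc M') (Fib d)))
          (fun b : ↥(pbox (fine Lc M')) × Fin (d + 1) => ((b.1, Sum.inl b.2) : Idx (fine Lc M') (Fib d))))
      = ∑ s : ↥(pbox (fine Lc M')), lam s • ∑ b : ↥(pbox (fine Lc M')) × Fin (d + 1), tgrad (fine Lc M') (b.1, Sum.inl b.2) s •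
        (perF (fine Lc M') (dper (fine Lc M') (wilsonA d b.2 (b.1 : Site (d + 1))))).submatrix
          (fun b : ↥(pbox (fine Lc M')) × Fin (d + 1) => ((b.1, Sum.inl b.2) : Idx (fine Lc M') (Fib d)))
          (fun b : ↥(pbox (fine Lc M')) × Fin (d + 1) => ((b.1, Sum.inl b.2) : Idx (fine Lc M') (Fib d))) := by
    simp only [Finset.sum_smul, Finset.smul_sum, smul_smul, mul_comm (lam _)]
    exact Finset.sum_comm
  rw [hswap, Finset.sum_congr rfl fun s _ => by rw [torus_H1_pureGauge M' s hH₀]]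
  ext x z
  simp only [Matrix.sum_apply, Matrix.smul_apply, Matrix.sub_apply, Matrix.diagonal_mul, Matrix.mul_diagonal, smul_eq_mul]
  rw [show lam z.1 = ∑ s : ↥(pbox (fine Lc M')), tdelta (fine Lc M') ((z.1 : ↥(pbox (fine Lc M'))) : Site (d + 1)) s * lam s by
      rw [sum_tdelta_mul, wrapPt_of_mem],
    show lam x.1 = ∑ s : ↥(pbox (fine Lc M')), tdelta (fine Lc M') ((x.1 : ↥(pbox (fine Lc M'))) : Site (d + 1)) s * lam s by
      rw [sum_tdelta_mul, wrapPt_of_mem]]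
  simp only [Finset.mul_sum, Finset.sum_mul, mul_sub, Finset.sum_sub_distrib]
  congr 1 <;> exact Finset.sum_congr rfl fun s _ => by ring

/-- [folklore] **THE LAW IN ITS OWN (COMMUTATOR) SHAPE, AS A GAUGE SHIFT OF THE DIRECTION** (OWNER F-FP-18-2 l.41032: «`H₁^{(h+Dλ)} − H₁^{(h)} = k·(H₀·E_λ − E_λ·H₀)`
with the tables' constant»): for EVERY direction `h` and EVERY torus gauge function `λ`, `H₁^{(h + Dλ)} − H₁^{(h)} = ½ • (H₀ * E_λ − E_λ * H₀)` — the constant of the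
UNWEIGHTED periodised Wilson family is `k = ½`. -/
theorem torus_H1_gauge_shift (h : ↥(pbox (fine Lc M')) × Fin (d + 1) → ℝ) (lam : ↥(pbox (fine Lc M')) → ℝ)
    {H₀ : Matrix (↥(pbox (fine Lc M')) × Fin (d + 1)) (↥(pbox (fine Lc M')) × Fin (d + 1)) ℝ}
    (hH₀ : H₀ = (perF (fine Lc M') (bhKStepAt d (toSite r) Lc 0)).submatrix
        (fun b : ↥(pbox (fine Lc M')) × Fin (d + 1) => ((b.1, Sum.inl b.2) : Idx (fine Lc M') (Fib d)))
        (fun b : ↥(pbox (fine Lc M')) × Fin (d + 1) => ((b.1, Sum.inl b.2) : Idx (fine Lc M') (Fib d)))) :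
    (∑ b : ↥(pbox (fine Lc M')) × Fin (d + 1), (h b + ∑ s : ↥(pbox (fine Lc M')), tgrad (fine Lc M') (b.1, Sum.inl b.2) s * lam s) •
        (perF (fine Lc M') (dper (fine Lc M') (wilsonA d b.2 (b.1 : Site (d + 1))))).submatrix
          (fun b : ↥(pbox (fine Lc M')) × Fin (d + 1) => ((b.1, Sum.inl b.2) : Idx (fine Lc M') (Fib d)))
          (fun b : ↥(pbox (fine Lc M')) × Fin (d + 1) => ((b.1, Sum.inl b.2) : Idx (fine Lc M') (Fib d))))
      - (∑ b : ↥(pbox (fine Lc M')) × Fin (d + 1), h b •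
        (perF (fine Lc M') (dper (fine Lc M') (wilsonA d b.2 (b.1 : Site (d + 1))))).submatrix
          (fun b : ↥(pbox (fine Lc M')) × Fin (d + 1) => ((b.1, Sum.inl b.2) : Idx (fine Lc M') (Fib d)))
          (fun b : ↥(pbox (fine Lc M')) × Fin (d + 1) => ((b.1, Sum.inl b.2) : Idx (fine Lc M') (Fib d))))
      = (1 / 2 : ℝ) • (H₀ * Matrix.diagonal (fun b : ↥(pbox (fine Lc M')) × Fin (d + 1) => lam b.1)
          - Matrix.diagonal (fun b : ↥(pbox (fine Lc M')) × Fin (d + 1) => lam b.1) * H₀) := by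
  rw [← torus_H1_pureGauge_fun M' lam hH₀]
  simp only [add_smul, Finset.sum_add_distrib]
  abel

end MatrixForm

/-! ## §4 Pure algebra: the congruence increment is symmetric, the commutator increment antisymmetric -/

section Words

/-- [folklore] for a symmetric `H₀`, the CONGRUENCE increment `Xᵀ·H₀ + H₀·X` is symmetric — for EVERY `X`. -/
theorem transpose_congr_increment {ν : Type*} [Fintype ν] (H₀ X : Matrix ν ν ℝ) (hH : H₀ᵀ = H₀) :
    (Xᵀ * H₀ + H₀ * X)ᵀ = Xᵀ * H₀ + H₀ * X := by
  rw [Matrix.transpose_add, Matrix.transpose_mul, Matrix.transpose_mul, Matrix.transpose_transpose, hH, add_comm]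

/-- [folklore] for a symmetric `H₀` and a diagonal generator, the COMMUTATOR increment `H₀·E − E·H₀` is antisymmetric. -/
theorem transpose_comm_diagonal {ν : Type*} [Fintype ν] [DecidableEq ν] (H₀ : Matrix ν ν ℝ) (e : ν → ℝ) (hH : H₀ᵀ = H₀) :
    (H₀ * Matrix.diagonal e - Matrix.diagonal e * H₀)ᵀ = -(H₀ * Matrix.diagonal e - Matrix.diagonal e * H₀) := by
  rw [Matrix.transpose_sub, Matrix.transpose_mul, Matrix.transpose_mul, Matrix.diagonal_transpose, hH, neg_sub]

/-- [folklore] middle cancellation in an additive commutative group: `A + S + B = S + D → A + B = D`. -/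
theorem add_mid_cancel {G : Type*} [AddCommGroup G] {A S B D : G} (h : A + S + B = S + D) : A + B = D := by
  have h' : A + B = A + S + B - S := by abel
  rw [h', h]
  abel

/-- [folklore] a real matrix that is both symmetric and antisymmetric vanishes. -/
theorem eq_zero_of_transpose_eq_of_transpose_eq_neg {ν : Type*} (T : Matrix ν ν ℝ) (h₁ : Tᵀ = T) (h₂ : Tᵀ = -T) : T = 0 := by
  have h : T = -T := h₁.symm.trans h₂
  ext i j
  have hij := congrFun (congrFun h i) j
  rw [Matrix.neg_apply] at hij
  rw [Matrix.zero_apply]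
  linarith

end Words

/-! ## §5 In the binder currency of `NestedStepLawTorusTransported` (p320614): a WEIGHTED form family `w • H₁`, the generator pinned DIAGONAL -/

section Letters

variable (M' : Fin (d + 1) → ℕ) [∀ μ, NeZero (M' μ)] {Lc : ℕ} [NeZero Lc] {r : Fin (d + 1) → ℕ}

/-- [folklore] **THE SIMILARITY-SHAPE LETTER WITH ANY WEIGHT** (OWNER W-FP-18-6: «display whatever constant the tables carry»): if the dictionary's level-0 form
insertion family is `w •` the periodised Wilson family (any `w : ℝ`) and the field generator is the DIAGONAL `X := (w/2) • E_λ`, then for EVERY direction `h`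
`−X * H₀ + w • H₁^{(h)} + H₀ * X = w • H₁^{(h + Dλ)}`.  At leaf-02's pin `X = −(c • E_λ)` (p320102 ∕ `…TorusTransportedRows`, `c = (Lc^{d+1}·stepScale d Lc j)⁻¹`) this is the
weight `w = −2c`. -/
theorem torus_k1_sim_letter (w : ℝ) (h : ↥(pbox (fine Lc M')) × Fin (d + 1) → ℝ) (lam : ↥(pbox (fine Lc M')) → ℝ)
    {H₀ : Matrix (↥(pbox (fine Lc M')) × Fin (d + 1)) (↥(pbox (fine Lc M')) × Fin (d + 1)) ℝ}
    (hH₀ : H₀ = (perF (fine Lc M') (bhKStepAt d (toSite r) Lc 0)).submatrix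
        (fun b : ↥(pbox (fine Lc M')) × Fin (d + 1) => ((b.1, Sum.inl b.2) : Idx (fine Lc M') (Fib d)))
        (fun b : ↥(pbox (fine Lc M')) × Fin (d + 1) => ((b.1, Sum.inl b.2) : Idx (fine Lc M') (Fib d))))
    {X : Matrix (↥(pbox (fine Lc M')) × Fin (d + 1)) (↥(pbox (fine Lc M')) × Fin (d + 1)) ℝ}
    (hX : X = (w / 2) • Matrix.diagonal (fun b : ↥(pbox (fine Lc M')) × Fin (d + 1) => lam b.1)) :
    -X * H₀
        + w • (∑ b : ↥(pbox (fine Lc M')) × Fin (d + 1), h b •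
            (perF (fine Lc M') (dper (fine Lc M') (wilsonA d b.2 (b.1 : Site (d + 1))))).submatrix
              (fun b : ↥(pbox (fine Lc M')) × Fin (d + 1) => ((b.1, Sum.inl b.2) : Idx (fine Lc M') (Fib d)))
              (fun b : ↥(pbox (fine Lc M')) × Fin (d + 1) => ((b.1, Sum.inl b.2) : Idx (fine Lc M') (Fib d))))
        + H₀ * X
      = w • ∑ b : ↥(pbox (fine Lc M')) × Fin (d + 1), (h b + ∑ s : ↥(pbox (fine Lc M')), tgrad (fine Lc M') (b.1, Sum.inl b.2) s * lam s) •
          (perF (fine Lc M') (dper (fine Lc M') (wilsonA d b.2 (b.1 : Site (d + 1))))).submatrix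
            (fun b : ↥(pbox (fine Lc M')) × Fin (d + 1) => ((b.1, Sum.inl b.2) : Idx (fine Lc M') (Fib d)))
            (fun b : ↥(pbox (fine Lc M')) × Fin (d + 1) => ((b.1, Sum.inl b.2) : Idx (fine Lc M') (Fib d))) := by
  subst hX
  simp only [add_smul, Finset.sum_add_distrib, smul_add]
  rw [torus_H1_pureGauge_fun M' lam hH₀, smul_smul, smul_sub, Matrix.neg_mul, Matrix.smul_mul, Matrix.mul_smul,
    show w * (1 / 2 : ℝ) = w / 2 by ring]
  abel

/-- [folklore] **THE CONGRUENCE-SHAPE LETTER (the `k1` binder of p320614, `Xᵀ * H₀ + H₁ + H₀ * X = H′₁`) WITH ANY WEIGHT, ANY `X`, IS MET ONLY WHERE THE WEIGHTED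
COMMUTATOR VANISHES**: `Xᵀ * H₀ + w • H₁^{(h)} + H₀ * X = w • H₁^{(h + Dλ)} → w • (H₀ * E_λ − E_λ * H₀) = 0 ∧ Xᵀ * H₀ + H₀ * X = 0` (so for `w ≠ 0` the form block would
commute with every diagonal torus gauge generator).  No constant repairs this: the left increment is symmetric for EVERY `X` (`torus_H₀_transpose`), the right one antisymmetric. -/
theorem torus_k1_congr_letter_only_if (w : ℝ) (h : ↥(pbox (fine Lc M')) × Fin (d + 1) → ℝ) (lam : ↥(pbox (fine Lc M')) → ℝ)
    {H₀ : Matrix (↥(pbox (fine Lc M')) × Fin (d + 1)) (↥(pbox (fine Lc M')) × Fin (d + 1)) ℝ}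
    (hH₀ : H₀ = (perF (fine Lc M') (bhKStepAt d (toSite r) Lc 0)).submatrix
        (fun b : ↥(pbox (fine Lc M')) × Fin (d + 1) => ((b.1, Sum.inl b.2) : Idx (fine Lc M') (Fib d)))
        (fun b : ↥(pbox (fine Lc M')) × Fin (d + 1) => ((b.1, Sum.inl b.2) : Idx (fine Lc M') (Fib d))))
    (X : Matrix (↥(pbox (fine Lc M')) × Fin (d + 1)) (↥(pbox (fine Lc M')) × Fin (d + 1)) ℝ)
    (k1 : Xᵀ * H₀
        + w • (∑ b : ↥(pbox (fine Lc M')) × Fin (d + 1), h b •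
            (perF (fine Lc M') (dper (fine Lc M') (wilsonA d b.2 (b.1 : Site (d + 1))))).submatrix
              (fun b : ↥(pbox (fine Lc M')) × Fin (d + 1) => ((b.1, Sum.inl b.2) : Idx (fine Lc M') (Fib d)))
              (fun b : ↥(pbox (fine Lc M')) × Fin (d + 1) => ((b.1, Sum.inl b.2) : Idx (fine Lc M') (Fib d))))
        + H₀ * X
      = w • ∑ b : ↥(pbox (fine Lc M')) × Fin (d + 1), (h b + ∑ s : ↥(pbox (fine Lc M')), tgrad (fine Lc M') (b.1, Sum.inl b.2) s * lam s) •
          (perF (fine Lc M') (dper (fine Lc M') (wilsonA d b.2 (b.1 : Site (d + 1))))).submatrix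
            (fun b : ↥(pbox (fine Lc M')) × Fin (d + 1) => ((b.1, Sum.inl b.2) : Idx (fine Lc M') (Fib d)))
            (fun b : ↥(pbox (fine Lc M')) × Fin (d + 1) => ((b.1, Sum.inl b.2) : Idx (fine Lc M') (Fib d)))) :
    w • (H₀ * Matrix.diagonal (fun b : ↥(pbox (fine Lc M')) × Fin (d + 1) => lam b.1)
          - Matrix.diagonal (fun b : ↥(pbox (fine Lc M')) × Fin (d + 1) => lam b.1) * H₀) = 0
      ∧ Xᵀ * H₀ + H₀ * X = 0 := by
  have hHt : H₀ᵀ = H₀ := torus_H₀_transpose M' 0 hH₀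
  simp only [add_smul, Finset.sum_add_distrib, smul_add] at k1
  have hinc : Xᵀ * H₀ + H₀ * X = w • ((1 / 2 : ℝ) • (H₀ * Matrix.diagonal (fun b : ↥(pbox (fine Lc M')) × Fin (d + 1) => lam b.1)
      - Matrix.diagonal (fun b : ↥(pbox (fine Lc M')) × Fin (d + 1) => lam b.1) * H₀)) := by
    rw [← torus_H1_pureGauge_fun M' lam hH₀]
    exact add_mid_cancel k1
  have hT : w • ((1 / 2 : ℝ) • (H₀ * Matrix.diagonal (fun b : ↥(pbox (fine Lc M')) × Fin (d + 1) => lam b.1)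
      - Matrix.diagonal (fun b : ↥(pbox (fine Lc M')) × Fin (d + 1) => lam b.1) * H₀)) = 0 := by
    refine eq_zero_of_transpose_eq_of_transpose_eq_neg _ ?_ ?_
    · rw [← hinc]; exact transpose_congr_increment H₀ X hHt
    · rw [Matrix.transpose_smul, Matrix.transpose_smul, transpose_comm_diagonal H₀ _ hHt, smul_neg, smul_neg]
  refine ⟨?_, by rw [hinc, hT]⟩
  rw [smul_smul, mul_comm, ← smul_smul] at hT
  rcases smul_eq_zero.1 hT with hc | hc
  · norm_num at hc
  · exact hc

end Letters

end Summit.QuantumFields.BalabanUV.Beta.FP.PeriodisedFormIndexWard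

end
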